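import Mathlib
import Literature.MathematicalPhysics.QuantumFieldTheory.Balaban1983to89.B13
import Literature.MathematicalPhysics.QuantumFieldTheory.Balaban1983to89.B13FamilySum
import Literature.Probability.LatticeModels.ClusterExpansionKPBound

/-!
# `Balaban1983to89.B13Resummation` — the resummation step (2.38) ⇒ (2.41) of T. Bałaban, *Renormalization group
approach to lattice gauge field theories. II. Cluster expansions*, Commun. Math. Phys. **116**, 1–22 (1988),
doi:10.1007/bf01239022 [Balaban1988RG2Cluster] (cell paper B13; PDF held `paper:balaban1988-cmp116-rg-ii-cluster`,
journal page = PDF page), pp. 14, 15, 20–21 — a KERNEL CERTIFICATE, from the Kotecký–Preiss theorem PROVED in the tree,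
for the located gap "(2.39)–(2.41) are justified only by *repeat all the considerations and bounds of the paper [26]*"
(cell GAPS.md G-B13-11; CITED-FACTS.md F-B13-1).

CITATION HEADER (lean-in-tree rule 2026-08-18).  The passage certified, p. 20 [PDF 20] last paragraph – p. 21 [PDF 21]
(2.41), verbatim from the page renders: *"The above lemma implies that sufficient conditions for convergence of the
series (2.12), (2.13) are satisfied, see [26, 67, 25, 50]. We want to prove the inequality (I.1.18) for E^{(k+1)}(X).
The series (2.13), defining E^{(k+1)}(X), is estimated in the standard way, each factor |H(Z)| is replaced by the
right-hand side of (2.38) in the bound."* (v2.1: middle sentence re-keyed from render p020-x4, cell GAPS.md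
G-pv11-2) … p. 21: *"extract the exponential exp(−δ½Lκd_{k+1}(Z_i)) from the i-th factor, and the remaining product
is estimated using (2.27), and the condition ∪Z_i = X, X is a connected domain. This yields*
  `|E^{(k+1)}(X)| ≤ exp(−(1 − 9δ)½Lκd_{k+1}(X)) exp(−5κ)
     · Σ_{n=1}^∞ (1/n!) Σ_{(Z₁,…,Z_n): ∪Z_i = X} |ρ^T(Z₁,…,Z_n)| Π_{i=1}^n C₃ε₁ exp 5κ exp(−δ½Lκd_{k+1}(Z_i)).`   (2.39)
*To the above sum we can repeat all the considerations and bounds of the paper [26], for κ sufficiently large, and ε₁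
sufficiently small. We obtain*
  `|E^{(k+1)}(X)| ≤ exp(−(1 − 9δ)½Lκd_{k+1}(X)) exp(−5κ) · Σ_{Z⊂X} C₃ε₁ exp 5κ exp(−½δLκd_{k+1}(Z)) O(1) exp 2(LM)⁻⁴|Z|.`   (2.40)
*The last sum is bounded by C₃ε₁ exp 5κ O(1)(LM)⁻⁴|X| ≤ C₃ε₁ exp 5κ O(1) exp(LM)⁻⁴|X|, and the last exponential
multiplied by exp(−½δLκd_{k+1}(X)) is bounded by 1. This yields*
  `|E^{(k+1)}(X)| ≤ O(1)C₃ε₁ exp(−(1 − 10δ)½Lκd_{k+1}(X)).`   (2.41)"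
([26] = C. Cammarota, *Decay of correlations for infinite range interactions in unbounded spin systems*, Commun. Math.
Phys. **85** (1982) 517–528, entry [26] of the reference list of [Balaban1987RG1].)  The tree module
`…Balaban1983to89.B13` (units r2/b13/b13-g2) enters this passage as the HYPOTHESIS
`B13.CammarotaStep : Bound238 S c → Bound241 S c` (general transfer factor: `B13.CammarotaStepWith S c ℓ`), the
polymer combinatorics (2.11)–(2.13) being unmodelled there (cell DIVERGENCE.md D-b13.1).

WHAT IS REPRODUCED (unit `b2b-balaban-pv18`, surge node prover #18).  THE COMBINATORIAL CONTENT OF THAT HYPOTHESIS,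
IN THE KERNEL, by a second, PUBLISHED and TREE-PROVED engine in place of [26]: the Kotecký–Preiss theorem —
R. Kotecký, D. Preiss, *Cluster expansion for abstract polymer models*, Commun. Math. Phys. **103** (1986) 491–498
[KoteckyPreiss1986], Theorem p. 492 with its estimate (4) — proved sorry-free in
`Literature.Probability.LatticeModels.ClusterExpansionKPBound` (`koteckyPreiss_truncatedWeight_bound_holds`;
consequences used: `sum_norm_truncatedWeight_le_exp_neg_mul`, `kp_hypothesis_of_fintype`, `isKPVolume_of_tsum_le`,
`polymerLogZ_eq_sum_truncatedWeight`, `exp_polymerLogZ_of_kp` of `…ClusterExpansion`).  Nothing of [26] and nothing of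
the series under audit is asserted: (2.38), (1.26) at scale k + 1, (2.27) at scale k + 1, the additive volume bound of
(2.30)-type and the identification (2.13) of E^{(k+1)}(X) enter ONLY as hypotheses, KP86 enters as a THEOREM, and
"κ sufficiently large, ε₁ sufficiently small" become two explicit inequalities (cell SMALLNESS.md).

## The polymer system (p. 14 [PDF 14], verbatim)

(2.11) *"Thus finally we obtain the polymer expansion (2.1) = Σ_{{Z₁,…,Z_n}} H(Z₁)⋯H(Z_n) = 1 + Σ_{n=1}^∞ (1/n!)
Σ_{(Z₁,…,Z_n)} Π_{{i,j},i<j} ζ(Z_i, Z_j)H(Z₁)⋯H(Z_n), (2.11) where the function ζ(Z, Z′) is defined by the condition: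
ζ(Z, Z′) = 0 if Z ∩ Z′ contains a cube, or a wall of a cube, and ζ(Z, Z′) = 1 otherwise. If the activities H(Z) of the
above polymer expansion are sufficiently small, then the polymer expansion can be exponentiated according to the
well-known formula, see [36, 60, 26, 25, 67, 50]. We obtain by (I.2.13), (1.41), (2.11)
E^{(k+1)} = Σ_{n=1}^∞ (1/n!) Σ_{(Z₁,…,Z_n)} ρ^T(Z₁,…,Z_n)H(Z₁)⋯H(Z_n), (2.12) where ρ^T(Z) = 1, and
ρ^T(Z₁,…,Z_n) = Σ_{g∈C_n} Π_{{i,j}∈g} (ζ(Z_i, Z_j) − 1), C_n is the set of connected graphs on the set {1,…,n}. The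
representation (I.1.7) for E^{(k+1)} is constructed by taking
E^{(k+1)}(X) = Σ_{n=1}^∞ (1/n!) Σ_{(Z₁,…,Z_n): ∪Z_i = X} ρ^T(Z₁,…,Z_n)H(Z₁)⋯H(Z_n), (2.13) where X ∈ 𝐃_{k+1}."*

Typed over an ABSTRACT finite polymer catalogue (as in `B13FamilySum`): a finite type `Dom` of polymers (𝐃_{k+1}
restricted to T_{M+N}), footprints `cubes : Dom → Finset Cube` (the LM-cubes of Z), tree lengths `d : Dom → ℝ`
(d_{k+1}), an incompatibility relation `ι` (ζ(Z, Z′) = 0; reflexive, symmetric) which is FOOTPRINT-LOCAL through a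
`reach : Dom → Finset Cube` (the cubes of Z together with the cubes sharing a wall with a cube of Z: `ι Z′ Z` forces
Z′ to contain a cube of `reach Z`, and `#reach Z ≤ ν · #cubes Z`, ν = 9 in four dimensions).  (2.11) is the tree's
`polymerPartitionFunction ι H univ`; for (2.12)/(2.13) we take the Kotecký–Preiss form of the "well-known formula":
E^{(k+1)} = log Ξ = Σ_C Φ^T(C) over sets C of polymers ([KP86, (2)–(3)], tree `polymerLogZ_eq_sum_truncatedWeight`,
`Φ^T` = `truncatedWeight`, supported on ι-clusters), and **E^{(k+1)}(X) := Σ_{C : ∪_{Z∈C} Z = X} Φ^T(C)** (`locE`) — the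
part of log Ξ localized in X.  The three properties of (2.13) the paper uses are PROVED for `locE`: log Ξ = Σ_X E(X)
(`logZ_eq_sum_locE`), exp of it is (2.11) under the smallness condition (`exp_sum_locE_eq_Z`), and E(X) depends only on
the activities H(Z), Z ⊂ X (`locE_congr`).  (That Φ^T(C) is also the sum of the Ursell terms (1/n!)ρ^T H(Z₁)⋯H(Z_n) over
the sequences with support C — the Mayer identity of [26, Thm 1], [25] — is classical and is not needed here.)

## What is proved (Parts B–D), and how it matches (2.39)–(2.41)

* `kp_condition` — the Kotecký–Preiss hypothesis (1) *Σ_{Z′ ι Z} |H(Z′)| e^{a(Z′)+d(Z′)} ≤ a(Z)* with a(Z) = τ·#cubes Z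
  and d(Z) = s·d_{k+1}(Z) + b, from: an activity bound |H(Z)| ≤ A e^{−R d_{k+1}(Z)} [(2.38): A = C₃ε₁, R = (1 − 8δ)ℓκ],
  (1.26) at scale k + 1 (`B13FamilySum.Ineq126`, rate κ₀, constant K₀), the volume bound `B13FamilySum.VolBound`
  (#cubes Z ≤ c₁(1 + d_{k+1}(Z)), the additive (2.30)), the rate condition κ₀ + s + τc₁ ≤ R and the smallness
  A e^{b + τc₁} K₀ ν ≤ τ.
* `norm_locE_le` — the anchored cluster bound: with (2.27) at scale k + 1 for the covering families of X
  (`B13FamilySum.Ineq227`, constant c; printed c = 5) and b ≥ r₁c: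
  |E(X)| ≤ τ c₁ K₀ e^{−b} e^{−r₁ d_{k+1}(X)}.  Route (the paper's, p. 21: *"extract the exponential exp(−δ½Lκd_{k+1}(Z_i))
  from the i-th factor, and the remaining product is estimated using (2.27), and the condition ∪Z_i = X, X is a
  connected domain"*): fix a cube □₀ of X; every C with ∪C = X has a member Z ∋ □₀; KP (4) at the polymer Z bounds
  Σ_{C ∋ Z, ∪C = X} |Φ^T(C)| ≤ e^{−ρ} a(Z) once ρ ≤ Σ_{Z′∈C} d(Z′) on those C, and (2.27) gives exactly
  Σ_{Z′∈C} (r₁ d(Z′) + b) ≥ r₁ d(X) + b (the per-member merging cost e^{b}, b ≥ r₁·5 — printed "exp 5κ"), while the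
  extra (κ₀ + 1)d(Z′) in d makes the anchor sum Σ_{Z ∋ □₀} converge by (1.26).  Compared with (2.40) no factor |X| appears
  (the anchor is one cube, not all Z ⊂ X), so the second δ of (1 − 9δ) → (1 − 10δ) is not spent.
* `norm_locE_le_of_small` — the (2.41) shape: choosing τ = A e^{b+1} K₀ ν,
  **|E(X)| ≤ (e ν c₁ K₀²) · A · e^{−r₁ d_{k+1}(X)}** provided **A e^{b+1} K₀ ν c₁ ≤ 1** ("ε₁ sufficiently small") and
  **r₁ + 2κ₀ + 2 ≤ R** ("κ sufficiently large"); the printed O(1) of (2.41) is e ν c₁ K₀².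
* Part E, the bridge to `B13.lean`: `Geometry` (footprints/reach/ι and the three geometric leaves for S.Dk1),
  `SpRestr` (p. 15 *"Of course Y ⊂ Z₀, and Z̃₀ ⊂ Z ⊂ X for the activities in (2.13) … therefore we can restrict them,
  as analytic functions, to the above subspace"* — the space on X restricts to the space on Z ⊂ X), `Repr213`
  (E^{(k+1)}(X) of `StepData` IS `locE` of the activities H(·)), and
  `cammarotaStepWith_of_KP : … → B13.CammarotaStepWith S c ℓ` with r₁ = (1 − 10δ)ℓκ, R = (1 − 8δ)ℓκ, b = 5r₁:
  the smallness clause reads C₃ε₁ e^{5(1−10δ)ℓκ + 1} K₀ ν c₁ ≤ 1, i.e. **C₃ε₁ e^{5κ+1} K₀ ν c₁ ≤ 1 under the closing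
  condition (1 − 10δ)ℓ = 1** (`smallness_exponent_of_R22gen`) — the printed "C₃ε₁ exp 5κ" of (2.39)/(2.40); and
  A₂ ≥ e ν c₁ K₀².  `cammarotaStep_of_KP` is ℓ = L/2 (the printed `CammarotaStep`).

* Part F (v2, append-only): the same in the printed letters under (1 − 10δ)ℓ = 1 (`cammarotaStepWith_of_KP_R22gen`:
  κ + 2κ₀ + 2 ≤ (1 − 8δ)ℓκ and C₃ε₁ e^{5κ+1} K₀ ν c₁ ≤ 1), and the §2 chain of `B13.lean` with the [26]-hypothesis replaced
  by them: `bound118_of_KP` ((I.1.18) with ½E₀ from (2.38)_ℓ), `deliverables_of_chainWith_KP`.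

Cell records: GAPS.md G-B13-11 (this = its kernel discharge modulo `Repr213` + the geometric leaves), SMALLNESS.md
(the two explicit inequalities), CITED-FACTS.md F-B13-1 (Cammarota — not used here) and the tree's [KoteckyPreiss1986].
-/

open Finset

noncomputable section

namespace Literature.MathematicalPhysics.QuantumFieldTheory.Balaban1983to89.B13Resummation

open Literature.Probability.LatticeModels
open Literature.MathematicalPhysics.QuantumFieldTheory.Balaban1983to89.B13FamilySum

variable {Dom Cube : Type*} [DecidableEq Dom] [DecidableEq Cube] [Fintype Dom]
variable (ι : Dom → Dom → Prop) [DecidableRel ι]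

/-! ## Part A. (2.12)/(2.13) in Kotecký–Preiss form: the X-localized part of log Ξ -/

/-- B13 (2.13) p. 14, verbatim: *"E^{(k+1)}(X) = Σ_{n=1}^∞ (1/n!) Σ_{(Z₁,…,Z_n): ∪Z_i = X} ρ^T(Z₁,…,Z_n)H(Z₁)⋯H(Z_n),
(2.13) where X ∈ 𝐃_{k+1}"* — in the Kotecký–Preiss form of the exponentiation formula (2.12) ([KP86, (2)]:
log Ξ = Σ_C Φ^T(C)): the sum of the truncated functionals `Φ^T(C; H)` (tree `truncatedWeight`) over the finite families
`C` of polymers whose union of footprints is exactly `X` (`B13FamilySum.coveringFamilies univ cubes X`).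
[cite: Balaban1988RG2Cluster, (2.13) p.14] -/
def locE (cubes : Dom → Finset Cube) (w : Dom → ℂ) (X : Finset Cube) : ℂ :=
  ∑ C ∈ coveringFamilies (Finset.univ : Finset Dom) cubes X, truncatedWeight ι w C

/-- E^{(k+1)}(X) depends only on the activities H(Z) of the polymers Z ⊂ X (p. 15: *"Z̃₀ ⊂ Z ⊂ X for the activities in
(2.13)"*). [cite: Balaban1988RG2Cluster, (2.13) p.14] -/
theorem locE_congr {cubes : Dom → Finset Cube} {w w' : Dom → ℂ} {X : Finset Cube}
    (h : ∀ Z, cubes Z ⊆ X → w Z = w' Z) : locE ι cubes w X = locE ι cubes w' X := by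
  refine Finset.sum_congr rfl fun C hC => truncatedWeight_congr fun Z hZ => h Z ?_
  rw [← (mem_coveringFamilies.1 hC).2]
  exact Finset.subset_biUnion_of_mem cubes hZ

/-- (2.12) localizes into (2.13): log Ξ = Σ_C Φ^T(C) = Σ_X E^{(k+1)}(X), the outer sum over the finitely many unions X
of families of polymers ([KP86, (2)] = tree `polymerLogZ_eq_sum_truncatedWeight`, regrouped by the union).
[cite: Balaban1988RG2Cluster, (2.12)–(2.13) p.14] -/
theorem logZ_eq_sum_locE (cubes : Dom → Finset Cube) (w : Dom → ℂ) :
    polymerLogZ ι w (Finset.univ : Finset Dom) =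
      ∑ X ∈ (Finset.univ : Finset Dom).powerset.image (fun C => C.biUnion cubes), locE ι cubes w X := by
  rw [polymerLogZ_eq_sum_truncatedWeight]
  unfold locE coveringFamilies
  exact (Finset.sum_fiberwise_of_maps_to (fun C hC => Finset.mem_image_of_mem _ hC) _).symm

/-! ## Part B. The Kotecký–Preiss condition (1) from (2.38), (1.26) and the volume bound -/

/-- **[KP86] hypothesis (1) for the polymer gas of (2.11).**  Footprint-local incompatibility (`ι Z′ Z` ⇒ Z′ contains a
cube of `reach Z`, `#reach Z ≤ ν #cubes Z`), activities |H(Z)| ≤ A e^{−R d(Z)} (the shape of (2.38)), (1.26) at rate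
κ₀ with constant K₀, the volume bound #cubes Z ≤ c₁(1 + d(Z)), the rate condition κ₀ + s + τc₁ ≤ R and the smallness
A e^{b+τc₁} K₀ ν ≤ τ give, with a(Z) = τ #cubes Z and d(Z) ↦ s d(Z) + b:
Σ_{Z′ ι Z} |H(Z′)| e^{a(Z′) + s d(Z′) + b} ≤ a(Z).  (p. 20: *"The above lemma implies that sufficient conditions for
convergence of the series (2.12), (2.13) are satisfied, see [26, 67, 25, 50]."*) [cite: Balaban1988RG2Cluster, p.20 (after (2.38))] -/
theorem kp_condition {cubes reach : Dom → Finset Cube} {d : Dom → ℝ} {w : Dom → ℂ}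
    {A R κ₀ K₀ c₁ τ s b ν : ℝ}
    (hloc : ∀ Z Z', ι Z' Z → ∃ q ∈ reach Z, q ∈ cubes Z')
    (hreach : ∀ Z, ((reach Z).card : ℝ) ≤ ν * (cubes Z).card)
    (hd : ∀ Z, 0 ≤ d Z) (hA : 0 ≤ A) (hK₀ : 0 ≤ K₀) (hτ : 0 ≤ τ)
    (hw : ∀ Z, ‖w Z‖ ≤ A * Real.exp (-(R * d Z)))
    (h126 : Ineq126 (Finset.univ : Finset Dom) cubes d κ₀ K₀)
    (hvol : VolBound (Finset.univ : Finset Dom) cubes d c₁)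
    (hrate : κ₀ + s + τ * c₁ ≤ R) (hsmall : A * Real.exp (b + τ * c₁) * K₀ * ν ≤ τ) (Z : Dom) :
    ∑ Z' ∈ Finset.univ with ι Z' Z,
        ‖w Z'‖ * Real.exp (τ * ((cubes Z').card : ℝ) + (s * d Z' + b)) ≤ τ * ((cubes Z).card : ℝ) := by
  set f : Dom → ℝ := fun Z' => ‖w Z'‖ * Real.exp (τ * ((cubes Z').card : ℝ) + (s * d Z' + b)) with hf
  have hf0 : ∀ Z', 0 ≤ f Z' := fun Z' => mul_nonneg (norm_nonneg _) (Real.exp_nonneg _)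
  -- footprint locality: every `Z' ι Z` contains a cube of `reach Z`
  have hcover : (Finset.univ.filter fun Z' => ι Z' Z) ⊆
      (reach Z).biUnion fun q => Finset.univ.filter fun Z' => q ∈ cubes Z' := by
    intro Z' hZ'
    obtain ⟨q, hq, hqZ'⟩ := hloc Z Z' (Finset.mem_filter.1 hZ').2
    exact Finset.mem_biUnion.2 ⟨q, hq, Finset.mem_filter.2 ⟨Finset.mem_univ _, hqZ'⟩⟩
  -- the pointwise bound `f Z' ≤ A e^{b + τ c₁} e^{-κ₀ d(Z')}`
  have hpt : ∀ Z', f Z' ≤ A * Real.exp (b + τ * c₁) * Real.exp (-(κ₀ * d Z')) := by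
    intro Z'
    have hv : τ * ((cubes Z').card : ℝ) ≤ τ * (c₁ * (1 + d Z')) :=
      mul_le_mul_of_nonneg_left (hvol Z' (Finset.mem_univ _)) hτ
    have hexp : -(R * d Z') + (τ * (c₁ * (1 + d Z')) + (s * d Z' + b)) =
        (b + τ * c₁) + -((R - τ * c₁ - s) * d Z') := by ring
    calc f Z' ≤ A * Real.exp (-(R * d Z')) * Real.exp (τ * (c₁ * (1 + d Z')) + (s * d Z' + b)) :=
          mul_le_mul (hw Z') (Real.exp_le_exp.2 (by linarith)) (Real.exp_nonneg _)
            (mul_nonneg hA (Real.exp_nonneg _))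
      _ = A * Real.exp (b + τ * c₁) * Real.exp (-((R - τ * c₁ - s) * d Z')) := by
          rw [mul_assoc, ← Real.exp_add, hexp, Real.exp_add, ← mul_assoc]
      _ ≤ A * Real.exp (b + τ * c₁) * Real.exp (-(κ₀ * d Z')) := by
          refine mul_le_mul_of_nonneg_left (Real.exp_le_exp.2 (neg_le_neg ?_))
            (mul_nonneg hA (Real.exp_nonneg _))
          exact mul_le_mul_of_nonneg_right (by linarith) (hd Z')
  -- (1.26) per anchoring cube, then the count of anchoring cubes
  have hq : ∀ q, ∑ Z' ∈ Finset.univ.filter (fun Z' => q ∈ cubes Z'), f Z' ≤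
      A * Real.exp (b + τ * c₁) * K₀ := fun q =>
    calc ∑ Z' ∈ Finset.univ.filter (fun Z' => q ∈ cubes Z'), f Z'
        ≤ ∑ Z' ∈ Finset.univ.filter (fun Z' => q ∈ cubes Z'),
            A * Real.exp (b + τ * c₁) * Real.exp (-(κ₀ * d Z')) := Finset.sum_le_sum fun Z' _ => hpt Z'
      _ = A * Real.exp (b + τ * c₁) *
            ∑ Z' ∈ Finset.univ.filter (fun Z' => q ∈ cubes Z'), Real.exp (-(κ₀ * d Z')) := by
          rw [Finset.mul_sum]
      _ ≤ A * Real.exp (b + τ * c₁) * K₀ :=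
          mul_le_mul_of_nonneg_left (h126 q) (mul_nonneg hA (Real.exp_nonneg _))
  calc ∑ Z' ∈ Finset.univ with ι Z' Z, f Z'
      ≤ ∑ Z' ∈ (reach Z).biUnion (fun q => Finset.univ.filter fun Z' => q ∈ cubes Z'), f Z' :=
        Finset.sum_le_sum_of_subset_of_nonneg hcover fun Z' _ _ => hf0 Z'
    _ ≤ ∑ q ∈ reach Z, ∑ Z' ∈ Finset.univ.filter (fun Z' => q ∈ cubes Z'), f Z' :=
        sum_biUnion_le_sum_of_nonneg _ _ f hf0
    _ ≤ ∑ q ∈ reach Z, A * Real.exp (b + τ * c₁) * K₀ := Finset.sum_le_sum fun q _ => hq q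
    _ = ((reach Z).card : ℝ) * (A * Real.exp (b + τ * c₁) * K₀) := by
        rw [Finset.sum_const, nsmul_eq_mul]
    _ ≤ ν * ((cubes Z).card : ℝ) * (A * Real.exp (b + τ * c₁) * K₀) :=
        mul_le_mul_of_nonneg_right (hreach Z)
          (mul_nonneg (mul_nonneg hA (Real.exp_nonneg _)) hK₀)
    _ = (A * Real.exp (b + τ * c₁) * K₀ * ν) * ((cubes Z).card : ℝ) := by ring
    _ ≤ τ * ((cubes Z).card : ℝ) := mul_le_mul_of_nonneg_right hsmall (Nat.cast_nonneg _)

/-- Under the hypotheses of `kp_condition`, (2.12) is the logarithm of (2.11): exp(Σ_X E^{(k+1)}(X)) = Ξ (p. 14: *"the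
polymer expansion can be exponentiated according to the well-known formula"*; [KP86] Theorem: zero-freeness and the
logarithm property, tree `exp_polymerLogZ_of_kp`). [cite: Balaban1988RG2Cluster, (2.11)–(2.12) p.14] -/
theorem exp_sum_locE_eq_Z [Std.Refl ι] [Std.Symm ι] {cubes reach : Dom → Finset Cube} {d : Dom → ℝ}
    {w : Dom → ℂ} {A R κ₀ K₀ c₁ τ s b ν : ℝ}
    (hloc : ∀ Z Z', ι Z' Z → ∃ q ∈ reach Z, q ∈ cubes Z')
    (hreach : ∀ Z, ((reach Z).card : ℝ) ≤ ν * (cubes Z).card)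
    (hd : ∀ Z, 0 ≤ d Z) (hA : 0 ≤ A) (hK₀ : 0 ≤ K₀) (hτ : 0 ≤ τ) (hs : 0 ≤ s) (hb : 0 ≤ b)
    (hw : ∀ Z, ‖w Z‖ ≤ A * Real.exp (-(R * d Z)))
    (h126 : Ineq126 (Finset.univ : Finset Dom) cubes d κ₀ K₀)
    (hvol : VolBound (Finset.univ : Finset Dom) cubes d c₁)
    (hrate : κ₀ + s + τ * c₁ ≤ R) (hsmall : A * Real.exp (b + τ * c₁) * K₀ * ν ≤ τ) :
    Complex.exp (∑ X ∈ (Finset.univ : Finset Dom).powerset.image (fun C => C.biUnion cubes),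
        locE ι cubes w X) = polymerPartitionFunction ι w Finset.univ := by
  have hkp := kp_condition ι hloc hreach hd hA hK₀ hτ hw h126 hvol hrate hsmall
  have h1 := fun γ => kp_hypothesis_of_fintype (inc := ι) (w := w)
    (a := fun Z => τ * ((cubes Z).card : ℝ)) (d := fun Z => s * d Z + b) hkp γ
  have hdK : ∀ Z, 0 ≤ s * d Z + b := fun Z => add_nonneg (mul_nonneg hs (hd Z)) hb
  -- (`a`, `d` are given by name: unifying them through `h1` is a non-pattern problem)
  have hKP : IsKPVolume ι w (fun Z => τ * ((cubes Z).card : ℝ)) (Finset.univ : Finset Dom) :=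
    isKPVolume_of_tsum_le (inc := ι) (w := w) (a := fun Z => τ * ((cubes Z).card : ℝ))
      (d := fun Z => s * d Z + b) hdK h1 Finset.univ
  have h := exp_polymerLogZ_of_kp hKP subset_rfl
  rwa [logZ_eq_sum_locE ι cubes w] at h

/-! ## Part C. The anchored cluster bound: (2.38) + (1.26) + (2.27) + volume ⇒ decay of E^{(k+1)}(X) -/

/-- **(2.39)–(2.41), general form.**  For a nonempty union X with (2.27) at scale k + 1 for its covering families
(constant c) and a per-member cost b ≥ r₁c: activities bounded by A e^{−R d(Z)} on the polymers Z ⊂ X, (1.26)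
(κ₀, K₀), the volume bound (c₁), footprint-local incompatibility (reach, ν), the rate condition
r₁ + 2κ₀ + 1 + τc₁ ≤ R and the smallness A e^{b+τc₁} K₀ ν ≤ τ give
|E^{(k+1)}(X)| ≤ τ c₁ K₀ e^{−b} e^{−r₁ d(X)}.  (p. 20–21: *"The series (2.13), defining E^{(k+1)}(X), is estimated in the
standard way, each factor |H(Z)| is replaced by the right-hand side of (2.38) in the bound. … extract the exponential
exp(−δ½Lκd_{k+1}(Z_i)) from the i-th factor, and the remaining product is estimated using (2.27), and the condition
∪Z_i = X, X is a connected domain."*) [cite: Balaban1988RG2Cluster, (2.39)–(2.41) p.21] -/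
theorem norm_locE_le [Std.Refl ι] [Std.Symm ι] {cubes reach : Dom → Finset Cube} {d : Dom → ℝ} {w : Dom → ℂ}
    {A R r₁ κ₀ K₀ c₁ c b τ ν dX : ℝ} {X : Finset Cube}
    (hloc : ∀ Z Z', ι Z' Z → ∃ q ∈ reach Z, q ∈ cubes Z')
    (hreach : ∀ Z, ((reach Z).card : ℝ) ≤ ν * (cubes Z).card)
    (hd : ∀ Z, 0 ≤ d Z) (hA : 0 ≤ A) (hK₀ : 0 ≤ K₀) (hc₁ : 0 ≤ c₁) (hτ : 0 ≤ τ) (hκ₀ : 0 ≤ κ₀)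
    (hr₁ : 0 ≤ r₁) (hc : 0 ≤ c) (hb : r₁ * c ≤ b)
    (hw : ∀ Z, cubes Z ⊆ X → ‖w Z‖ ≤ A * Real.exp (-(R * d Z)))
    (h126 : Ineq126 (Finset.univ : Finset Dom) cubes d κ₀ K₀)
    (hvol : VolBound (Finset.univ : Finset Dom) cubes d c₁)
    (h227 : Ineq227 (Finset.univ : Finset Dom) cubes d X dX c)
    (hrate : r₁ + 2 * κ₀ + 1 + τ * c₁ ≤ R) (hsmall : A * Real.exp (b + τ * c₁) * K₀ * ν ≤ τ)
    (hX : X.Nonempty) :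
    ‖locE ι cubes w X‖ ≤ τ * c₁ * K₀ * Real.exp (-b) * Real.exp (-(r₁ * dX)) := by
  -- pass to the activities truncated to the polymers inside `X`
  set w' : Dom → ℂ := fun Z => if cubes Z ⊆ X then w Z else 0 with hw'_def
  have hw' : ∀ Z, ‖w' Z‖ ≤ A * Real.exp (-(R * d Z)) := by
    intro Z
    by_cases h : cubes Z ⊆ X
    · simp only [hw'_def, h, if_true]
      exact hw Z h
    · simp only [hw'_def, h, if_false, norm_zero]
      exact mul_nonneg hA (Real.exp_nonneg _)
  rw [locE_congr ι (w := w) (w' := w') (fun Z hZ => by simp only [hw'_def, hZ, if_true])]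
  -- Kotecký–Preiss data: `a(Z) = τ #cubes Z`, `d(Z) = (r₁ + (κ₀ + 1)) d(Z) + b`
  have hb0 : 0 ≤ b := le_trans (mul_nonneg hr₁ hc) hb
  have ha : ∀ Z, 0 ≤ τ * ((cubes Z).card : ℝ) := fun Z => mul_nonneg hτ (Nat.cast_nonneg _)
  have hdK : ∀ Z, 0 ≤ (r₁ + (κ₀ + 1)) * d Z + b := fun Z =>
    add_nonneg (mul_nonneg (by linarith) (hd Z)) hb0
  have hkp := kp_condition ι hloc hreach hd hA hK₀ hτ hw' h126 hvol (s := r₁ + (κ₀ + 1)) (b := b)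
    (by linarith) hsmall
  have h1 := fun γ => kp_hypothesis_of_fintype (inc := ι) (w := w')
    (a := fun Z => τ * ((cubes Z).card : ℝ)) (d := fun Z => (r₁ + (κ₀ + 1)) * d Z + b) hkp γ
  have hfact := koteckyPreiss_truncatedWeight_bound_holds ι w'
    (fun Z => τ * ((cubes Z).card : ℝ)) (fun Z => (r₁ + (κ₀ + 1)) * d Z + b)
  -- the anchor cube
  obtain ⟨q₀, hq₀⟩ := hX
  set 𝒞 : Finset (Finset Dom) := coveringFamilies (Finset.univ : Finset Dom) cubes X with h𝒞
  have hcover : 𝒞 ⊆ (Finset.univ.filter fun Z => q₀ ∈ cubes Z).biUnion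
      (fun Z => 𝒞.filter fun C => Z ∈ C) := by
    intro C hC
    have hU : C.biUnion cubes = X := (mem_coveringFamilies.1 hC).2
    have hq : q₀ ∈ C.biUnion cubes := by rw [hU]; exact hq₀
    obtain ⟨Z, hZC, hqZ⟩ := Finset.mem_biUnion.1 hq
    exact Finset.mem_biUnion.2 ⟨Z, Finset.mem_filter.2 ⟨Finset.mem_univ _, hqZ⟩,
      Finset.mem_filter.2 ⟨hC, hZC⟩⟩
  -- KP estimate (4) at each anchoring polymer, with the (2.27)-extraction of the union's decay
  have hanchor : ∀ Z, ∑ C ∈ 𝒞 with Z ∈ C, ‖truncatedWeight ι w' C‖ ≤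
      Real.exp (-((r₁ * dX + b) + (κ₀ + 1) * d Z)) * (τ * ((cubes Z).card : ℝ)) := by
    intro Z
    refine sum_norm_truncatedWeight_le_exp_neg_mul hfact ha hdK h1 𝒞 Z fun C hC hZC => ?_
    -- goal: `(r₁ dX + b) + (κ₀+1) d Z ≤ Σ_{Z'∈C} ((r₁ + (κ₀+1)) d Z' + b)`
    have h227C : dX + c ≤ ∑ Z' ∈ C, (d Z' + c) := h227 C hC
    rw [Finset.sum_add_distrib, Finset.sum_const, nsmul_eq_mul] at h227C
    rw [Finset.sum_add_distrib, Finset.sum_const, nsmul_eq_mul, ← Finset.mul_sum]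
    have hcard : (1 : ℝ) ≤ (C.card : ℝ) := by exact_mod_cast Finset.card_pos.2 ⟨Z, hZC⟩
    have hsingle : d Z ≤ ∑ Z' ∈ C, d Z' := Finset.single_le_sum (fun Z' _ => hd Z') hZC
    have hkey : (r₁ + (κ₀ + 1)) * (∑ Z' ∈ C, d Z') + (C.card : ℝ) * b -
        ((r₁ * dX + b) + (κ₀ + 1) * d Z) =
        r₁ * ((∑ Z' ∈ C, d Z') + (C.card : ℝ) * c - (dX + c)) + (κ₀ + 1) * ((∑ Z' ∈ C, d Z') - d Z) +
          ((C.card : ℝ) - 1) * (b - r₁ * c) := by ring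
    have t₁ : 0 ≤ r₁ * ((∑ Z' ∈ C, d Z') + (C.card : ℝ) * c - (dX + c)) :=
      mul_nonneg hr₁ (sub_nonneg.2 h227C)
    have t₂ : 0 ≤ (κ₀ + 1) * ((∑ Z' ∈ C, d Z') - d Z) := mul_nonneg (by linarith) (sub_nonneg.2 hsingle)
    have t₃ : 0 ≤ ((C.card : ℝ) - 1) * (b - r₁ * c) := mul_nonneg (sub_nonneg.2 hcard) (sub_nonneg.2 hb)
    linarith
  -- per anchoring polymer: `e^{-(P + (κ₀+1)d)} τ #cubes ≤ e^{-P} τ c₁ e^{-κ₀ d}`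
  have hper : ∀ Z, Real.exp (-((r₁ * dX + b) + (κ₀ + 1) * d Z)) * (τ * ((cubes Z).card : ℝ)) ≤
      Real.exp (-(r₁ * dX + b)) * (τ * c₁) * Real.exp (-(κ₀ * d Z)) := by
    intro Z
    have hv : τ * ((cubes Z).card : ℝ) ≤ τ * c₁ * Real.exp (d Z) := by
      have h1' : ((cubes Z).card : ℝ) ≤ c₁ * (1 + d Z) := hvol Z (Finset.mem_univ _)
      have h2' : c₁ * (1 + d Z) ≤ c₁ * Real.exp (d Z) :=
        mul_le_mul_of_nonneg_left (by linarith [Real.add_one_le_exp (d Z)]) hc₁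
      calc τ * ((cubes Z).card : ℝ) ≤ τ * (c₁ * Real.exp (d Z)) :=
            mul_le_mul_of_nonneg_left (h1'.trans h2') hτ
        _ = τ * c₁ * Real.exp (d Z) := by ring
    have hsplit : Real.exp (-((r₁ * dX + b) + (κ₀ + 1) * d Z)) * Real.exp (d Z) =
        Real.exp (-(r₁ * dX + b)) * Real.exp (-(κ₀ * d Z)) := by
      rw [← Real.exp_add, ← Real.exp_add]
      congr 1
      ring
    calc Real.exp (-((r₁ * dX + b) + (κ₀ + 1) * d Z)) * (τ * ((cubes Z).card : ℝ))
        ≤ Real.exp (-((r₁ * dX + b) + (κ₀ + 1) * d Z)) * (τ * c₁ * Real.exp (d Z)) :=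
          mul_le_mul_of_nonneg_left hv (Real.exp_nonneg _)
      _ = Real.exp (-((r₁ * dX + b) + (κ₀ + 1) * d Z)) * Real.exp (d Z) * (τ * c₁) := by ring
      _ = Real.exp (-(r₁ * dX + b)) * (τ * c₁) * Real.exp (-(κ₀ * d Z)) := by rw [hsplit]; ring
  -- assembly
  calc ‖locE ι cubes w' X‖ = ‖∑ C ∈ 𝒞, truncatedWeight ι w' C‖ := rfl
    _ ≤ ∑ C ∈ 𝒞, ‖truncatedWeight ι w' C‖ := norm_sum_le _ _
    _ ≤ ∑ C ∈ (Finset.univ.filter fun Z => q₀ ∈ cubes Z).biUnion (fun Z => 𝒞.filter fun C => Z ∈ C),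
          ‖truncatedWeight ι w' C‖ :=
        Finset.sum_le_sum_of_subset_of_nonneg hcover fun C _ _ => norm_nonneg _
    _ ≤ ∑ Z ∈ Finset.univ.filter (fun Z => q₀ ∈ cubes Z), ∑ C ∈ 𝒞.filter (fun C => Z ∈ C),
          ‖truncatedWeight ι w' C‖ :=
        sum_biUnion_le_sum_of_nonneg _ _ _ fun C => norm_nonneg _
    _ ≤ ∑ Z ∈ Finset.univ.filter (fun Z => q₀ ∈ cubes Z),
          Real.exp (-((r₁ * dX + b) + (κ₀ + 1) * d Z)) * (τ * ((cubes Z).card : ℝ)) :=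
        Finset.sum_le_sum fun Z _ => hanchor Z
    _ ≤ ∑ Z ∈ Finset.univ.filter (fun Z => q₀ ∈ cubes Z),
          Real.exp (-(r₁ * dX + b)) * (τ * c₁) * Real.exp (-(κ₀ * d Z)) :=
        Finset.sum_le_sum fun Z _ => hper Z
    _ = Real.exp (-(r₁ * dX + b)) * (τ * c₁) *
          ∑ Z ∈ Finset.univ.filter (fun Z => q₀ ∈ cubes Z), Real.exp (-(κ₀ * d Z)) := by
        rw [Finset.mul_sum]
    _ ≤ Real.exp (-(r₁ * dX + b)) * (τ * c₁) * K₀ :=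
        mul_le_mul_of_nonneg_left (h126 q₀) (mul_nonneg (Real.exp_nonneg _) (mul_nonneg hτ hc₁))
    _ = τ * c₁ * K₀ * Real.exp (-b) * Real.exp (-(r₁ * dX)) := by
        rw [neg_add, Real.exp_add]; ring

/-! ## Part D. The (2.41) shape: "ε₁ sufficiently small, κ sufficiently large" made explicit -/

/-- **(2.41), kernel form.**  With τ = A e^{b+1} K₀ ν in `norm_locE_le`: if **A e^{b+1} K₀ ν c₁ ≤ 1** ("ε₁ sufficiently
small") and **r₁ + 2κ₀ + 2 ≤ R** ("κ sufficiently large"), then for every nonempty union X with (2.27) for its covering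
families, **|E^{(k+1)}(X)| ≤ (e ν c₁ K₀²) · A · e^{−r₁ d(X)}** — p. 21 (2.41) verbatim: *"|E^{(k+1)}(X)| ≤ O(1)C₃ε₁
exp(−(1 − 10δ)½Lκd_{k+1}(X))"* with A = C₃ε₁, r₁ = (1 − 10δ)½Lκ, R = (1 − 8δ)½Lκ, b = 5r₁, O(1) = e ν c₁ K₀².
[cite: Balaban1988RG2Cluster, (2.41) p.21] -/
theorem norm_locE_le_of_small [Std.Refl ι] [Std.Symm ι] {cubes reach : Dom → Finset Cube} {d : Dom → ℝ}
    {w : Dom → ℂ} {A R r₁ κ₀ K₀ c₁ c b ν dX : ℝ} {X : Finset Cube}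
    (hloc : ∀ Z Z', ι Z' Z → ∃ q ∈ reach Z, q ∈ cubes Z')
    (hreach : ∀ Z, ((reach Z).card : ℝ) ≤ ν * (cubes Z).card)
    (hd : ∀ Z, 0 ≤ d Z) (hA : 0 ≤ A) (hK₀ : 0 ≤ K₀) (hc₁ : 0 ≤ c₁) (hν : 0 ≤ ν) (hκ₀ : 0 ≤ κ₀)
    (hr₁ : 0 ≤ r₁) (hc : 0 ≤ c) (hb : r₁ * c ≤ b)
    (hw : ∀ Z, cubes Z ⊆ X → ‖w Z‖ ≤ A * Real.exp (-(R * d Z)))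
    (h126 : Ineq126 (Finset.univ : Finset Dom) cubes d κ₀ K₀)
    (hvol : VolBound (Finset.univ : Finset Dom) cubes d c₁)
    (h227 : Ineq227 (Finset.univ : Finset Dom) cubes d X dX c)
    (hrate : r₁ + 2 * κ₀ + 2 ≤ R) (hsmall : A * Real.exp (b + 1) * K₀ * ν * c₁ ≤ 1) (hX : X.Nonempty) :
    ‖locE ι cubes w X‖ ≤ Real.exp 1 * ν * c₁ * K₀ ^ 2 * A * Real.exp (-(r₁ * dX)) := by
  set τ : ℝ := A * Real.exp (b + 1) * K₀ * ν with hτ_def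
  have hτ : 0 ≤ τ := mul_nonneg (mul_nonneg (mul_nonneg hA (Real.exp_nonneg _)) hK₀) hν
  have hτc : τ * c₁ ≤ 1 := hsmall
  have hsmall' : A * Real.exp (b + τ * c₁) * K₀ * ν ≤ τ := by
    have hexp : Real.exp (b + τ * c₁) ≤ Real.exp (b + 1) := Real.exp_le_exp.2 (by linarith)
    calc A * Real.exp (b + τ * c₁) * K₀ * ν ≤ A * Real.exp (b + 1) * K₀ * ν := by gcongr
      _ = τ := rfl
  have h := norm_locE_le ι hloc hreach hd hA hK₀ hc₁ hτ hκ₀ hr₁ hc hb hw h126 hvol h227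
    (by linarith) hsmall' hX
  have hcancel : Real.exp (b + 1) * Real.exp (-b) = Real.exp 1 := by
    rw [← Real.exp_add]; congr 1; ring
  calc ‖locE ι cubes w X‖ ≤ τ * c₁ * K₀ * Real.exp (-b) * Real.exp (-(r₁ * dX)) := h
    _ = (Real.exp (b + 1) * Real.exp (-b)) * (ν * c₁ * K₀ ^ 2 * A * Real.exp (-(r₁ * dX))) := by
        rw [hτ_def]; ring
    _ = Real.exp 1 * ν * c₁ * K₀ ^ 2 * A * Real.exp (-(r₁ * dX)) := by rw [hcancel]; ring

end Literature.MathematicalPhysics.QuantumFieldTheory.Balaban1983to89.B13Resummation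

/-! ## Part E. The bridge to `B13.lean`: (2.38) ⇒ (2.41) for the abstract `StepData` -/

namespace Literature.MathematicalPhysics.QuantumFieldTheory.Balaban1983to89.B13Resummation

open Literature.Probability.LatticeModels
open Literature.MathematicalPhysics.QuantumFieldTheory.Balaban1983to89.B13FamilySum
open Literature.MathematicalPhysics.QuantumFieldTheory.Balaban1983to89.B13

/-- The polymer geometry of 𝐃_{k+1} that the [26]-step consumes (B12 p. 257 definitions; B13 (2.11) p. 14, (1.26) p. 8,
(2.27) p. 18, (2.30) p. 18): footprints (the LM-cubes of X, nonempty), the incompatibility *"ζ(Z, Z′) = 0 if Z ∩ Z′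
contains a cube, or a wall of a cube"* (reflexive, symmetric, footprint-local through `reach` = the cubes of Z and the
cubes sharing a wall with one of them, `#reach Z ≤ ν #cubes Z`), (1.26) at scale k + 1 with rate κ₀ and constant K₀,
the additive volume bound #cubes X ≤ c₁(1 + d_{k+1}(X)) and (2.27) at scale k + 1 with its printed constant 5 for the
covering families of every X ∈ 𝐃_{k+1}.  A HYPOTHESIS structure: an instance is to be constructed by the joiner from
the concrete lattice geometry (cell TEMPLATE.md §15). [cite: Balaban1988RG2Cluster, (2.11) p.14] -/
structure Geometry (D : LocDomainSys) (Cube : Type) [DecidableEq Cube] where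
  cubes : D.Dom → Finset Cube
  reach : D.Dom → Finset Cube
  ι : D.Dom → D.Dom → Prop
  ν : ℝ
  κ₀ : ℝ
  K₀ : ℝ
  c₁ : ℝ
  cubes_nonempty : ∀ Z, (cubes Z).Nonempty
  ι_refl : ∀ Z, ι Z Z
  ι_symm : ∀ Z Z', ι Z Z' → ι Z' Z
  loc : ∀ Z Z', ι Z' Z → ∃ q ∈ reach Z, q ∈ cubes Z'
  reach_le : ∀ Z, ((reach Z).card : ℝ) ≤ ν * (cubes Z).card
  ν_nonneg : 0 ≤ ν
  κ₀_nonneg : 0 ≤ κ₀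
  K₀_nonneg : 0 ≤ K₀
  c₁_nonneg : 0 ≤ c₁
  ineq126 : Ineq126 (Finset.univ : Finset D.Dom) cubes D.dj κ₀ K₀
  volBound : VolBound (Finset.univ : Finset D.Dom) cubes D.dj c₁
  ineq227 : ∀ X, Ineq227 (Finset.univ : Finset D.Dom) cubes D.dj (cubes X) (D.dj X) 5

/-- p. 15 [PDF 15], verbatim: *"Of course Y ⊂ Z₀, and Z̃₀ ⊂ Z ⊂ X for the activities in (2.13). The potentials are also
analytic functions on the subspace Uᶜ_{k+1}(X, α₀, α₁). The quadratic forms and covariances in H(Z) are analytic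
functions on the space of configurations (𝐔, 𝐉) satisfying the conditions I.(i)–(iii) on the domain Z, with constants
α′₀, α′₁ much bigger than α₀, α₁, therefore we can restrict them, as analytic functions, to the above subspace."* —
typed: a configuration in the space on X lies in the space on every Z ⊂ X. [cite: Balaban1988RG2Cluster, p.15] -/
def SpRestr (S : B13.StepData) {Cube : Type} [DecidableEq Cube] (G : Geometry S.Dk1 Cube) : Prop :=
  ∀ X Z φ, G.cubes Z ⊆ G.cubes X → φ ∈ S.sp2 X → φ ∈ S.sp2 Z

open Classical in
/-- (2.13) p. 14 as the DEFINITION of the abstract `StepData.Ek1`: *"The representation (I.1.7) for E^{(k+1)} is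
constructed by taking E^{(k+1)}(X) = Σ_{n=1}^∞ (1/n!) Σ_{(Z₁,…,Z_n): ∪Z_i = X} ρ^T(Z₁,…,Z_n)H(Z₁)⋯H(Z_n), (2.13)"* —
E^{(k+1)}(X, φ) is the X-localized part `locE` of log Ξ of the polymer gas (2.11) with activities Z ↦ H(Z, φ)
(Kotecký–Preiss form). [cite: Balaban1988RG2Cluster, (2.13) p.14] -/
def Repr213 (S : B13.StepData) {Cube : Type} [DecidableEq Cube] (G : Geometry S.Dk1 Cube) : Prop :=
  ∀ X φ, φ ∈ S.sp2 X → S.Ek1 X φ = locE G.ι G.cubes (fun Z => S.H Z φ) (G.cubes X)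

/-- Under the closing condition (1 − 10δ)ℓ = 1 (`Consts.R22gen`; printed ℓ = L/2, p. 21 *"At first we assume that
(1 − 10δ)½L = 1"*) the smallness exponent 5(1 − 10δ)ℓκ + 1 of `cammarotaStepWith_of_KP` is 5κ + 1: the activity with its
merging cost is the printed *"C₃ε₁ exp 5κ"* of (2.39)/(2.40) (times e). [cite: Balaban1988RG2Cluster, (2.39) p.21] -/
theorem smallness_exponent_of_R22gen (c : B13.Consts) {ℓ : ℝ} (h22 : c.R22gen ℓ) :
    5 * ((1 - 10 * c.δ) * ℓ * c.κ) + 1 = 5 * c.κ + 1 := by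
  have h : (1 - 10 * c.δ) * ℓ = 1 := h22
  rw [h]; ring

open Classical in
/-- **G-B13-11 discharged in the kernel (general transfer factor ℓ).**  Given the polymer geometry of 𝐃_{k+1}, the
restriction property of the spaces (p. 15) and the representation (2.13) of E^{(k+1)}(X), the [26]-step
(2.38)_ℓ ⇒ (2.41)_ℓ = `B13.CammarotaStepWith S c ℓ` HOLDS as soon as
"κ sufficiently large" := (1 − 10δ)ℓκ + 2κ₀ + 2 ≤ (1 − 8δ)ℓκ (i.e. 2δℓκ ≥ 2κ₀ + 2),
"ε₁ sufficiently small" := C₃ε₁ · e^{5(1−10δ)ℓκ + 1} · K₀ ν c₁ ≤ 1 (= C₃ε₁ e^{5κ+1} K₀νc₁ ≤ 1 under (1 − 10δ)ℓ = 1,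
`smallness_exponent_of_R22gen`), and the printed O(1) =: A₂ ≥ e ν c₁ K₀².  Engine: [KP86] Theorem (tree-proved),
NOT [26]. [cite: Balaban1988RG2Cluster, (2.39)–(2.41) p.21] -/
theorem cammarotaStepWith_of_KP (S : B13.StepData) (c : B13.Consts) (ℓ : ℝ) {Cube : Type} [DecidableEq Cube]
    (G : Geometry S.Dk1 Cube) (hsp : SpRestr S G) (hrep : Repr213 S G)
    (hA : 0 ≤ c.C3act * c.ε₁) (hr₁ : 0 ≤ (1 - 10 * c.δ) * ℓ * c.κ)
    (hlarge : (1 - 10 * c.δ) * ℓ * c.κ + 2 * G.κ₀ + 2 ≤ (1 - 8 * c.δ) * ℓ * c.κ)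
    (hsmall : c.C3act * c.ε₁ * Real.exp (5 * ((1 - 10 * c.δ) * ℓ * c.κ) + 1) * G.K₀ * G.ν * G.c₁ ≤ 1)
    (hA₂ : Real.exp 1 * G.ν * G.c₁ * G.K₀ ^ 2 ≤ c.A₂) :
    CammarotaStepWith S c ℓ := by
  intro h238 X φ hφ
  haveI : Std.Refl G.ι := ⟨G.ι_refl⟩
  haveI : Std.Symm G.ι := ⟨G.ι_symm⟩
  rw [hrep X φ hφ]
  have hw : ∀ Z, G.cubes Z ⊆ G.cubes X → ‖S.H Z φ‖ ≤
      c.C3act * c.ε₁ * Real.exp (-((1 - 8 * c.δ) * ℓ * c.κ * S.Dk1.dj Z)) :=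
    fun Z hZ => h238 Z φ (hsp X Z φ hZ hφ)
  have h := norm_locE_le_of_small G.ι (w := fun Z => S.H Z φ) (R := (1 - 8 * c.δ) * ℓ * c.κ)
    (r₁ := (1 - 10 * c.δ) * ℓ * c.κ) (b := 5 * ((1 - 10 * c.δ) * ℓ * c.κ)) (c := 5)
    G.loc G.reach_le S.Dk1.dj_nonneg hA G.K₀_nonneg G.c₁_nonneg G.ν_nonneg G.κ₀_nonneg hr₁
    (by norm_num) (le_of_eq (by ring)) (fun Z hZ => by simpa [mul_assoc] using hw Z hZ) G.ineq126 G.volBound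
    (G.ineq227 X) (by linarith) hsmall (G.cubes_nonempty X)
  have hE : 0 ≤ Real.exp (-((1 - 10 * c.δ) * ℓ * c.κ * S.Dk1.dj X)) := Real.exp_nonneg _
  calc ‖locE G.ι G.cubes (fun Z => S.H Z φ) (G.cubes X)‖
      ≤ Real.exp 1 * G.ν * G.c₁ * G.K₀ ^ 2 * (c.C3act * c.ε₁) *
          Real.exp (-((1 - 10 * c.δ) * ℓ * c.κ * S.Dk1.dj X)) := by simpa [mul_assoc] using h
    _ ≤ c.A₂ * (c.C3act * c.ε₁) * Real.exp (-((1 - 10 * c.δ) * ℓ * c.κ * S.Dk1.dj X)) := by gcongr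
    _ = c.A₂ * c.C3act * c.ε₁ * Real.exp (-((1 - 10 * c.δ) * ℓ * c.κ * S.Dk1.dj X)) := by ring

open Classical in
/-- **G-B13-11 discharged in the kernel, printed transfer factor ℓ = L/2**: the hypotheses of `cammarotaStepWith_of_KP`
at ℓ = L/2 give `B13.CammarotaStep S c` = (2.38) ⇒ (2.41) as printed. [cite: Balaban1988RG2Cluster, (2.39)–(2.41) p.21] -/
theorem cammarotaStep_of_KP (S : B13.StepData) (c : B13.Consts) {Cube : Type} [DecidableEq Cube]
    (G : Geometry S.Dk1 Cube) (hsp : SpRestr S G) (hrep : Repr213 S G)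
    (hA : 0 ≤ c.C3act * c.ε₁) (hr₁ : 0 ≤ (1 - 10 * c.δ) * ((c.L : ℝ) / 2) * c.κ)
    (hlarge : (1 - 10 * c.δ) * ((c.L : ℝ) / 2) * c.κ + 2 * G.κ₀ + 2 ≤ (1 - 8 * c.δ) * ((c.L : ℝ) / 2) * c.κ)
    (hsmall : c.C3act * c.ε₁ * Real.exp (5 * ((1 - 10 * c.δ) * ((c.L : ℝ) / 2) * c.κ) + 1) *
      G.K₀ * G.ν * G.c₁ ≤ 1)
    (hA₂ : Real.exp 1 * G.ν * G.c₁ * G.K₀ ^ 2 ≤ c.A₂) :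
    CammarotaStep S c :=
  cammarotaStepWith_of_KP S c ((c.L : ℝ) / 2) G hsp hrep hA hr₁ hlarge hsmall hA₂

/-! ## Part F. The §2 chain of `B13.lean` without the [26]-hypothesis (append-only, v2) -/

/-- `cammarotaStepWith_of_KP` in the printed letters, under the closing condition (1 − 10δ)ℓ = 1 of p. 21 (*"At first we
assume that (1 − 10δ)½L = 1"*; `Consts.R22gen`, printed ℓ = ½L): then (1 − 10δ)ℓκ = κ, so "κ sufficiently large" reads
κ + 2κ₀ + 2 ≤ (1 − 8δ)ℓκ and "ε₁ sufficiently small" reads C₃ε₁ e^{5κ+1} K₀ ν c₁ ≤ 1 — the activity-with-merging-cost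
*"C₃ε₁ exp 5κ"* of (2.39)/(2.40). [cite: Balaban1988RG2Cluster, (2.39)–(2.41) p.21] -/
theorem cammarotaStepWith_of_KP_R22gen (S : B13.StepData) (c : B13.Consts) {ℓ : ℝ} {Cube : Type} [DecidableEq Cube]
    (G : Geometry S.Dk1 Cube) (hsp : SpRestr S G) (hrep : Repr213 S G) (h22 : c.R22gen ℓ)
    (hA : 0 ≤ c.C3act * c.ε₁) (hκ : 0 ≤ c.κ) (hlarge : c.κ + 2 * G.κ₀ + 2 ≤ (1 - 8 * c.δ) * ℓ * c.κ)
    (hsmall : c.C3act * c.ε₁ * Real.exp (5 * c.κ + 1) * G.K₀ * G.ν * G.c₁ ≤ 1)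
    (hA₂ : Real.exp 1 * G.ν * G.c₁ * G.K₀ ^ 2 ≤ c.A₂) :
    CammarotaStepWith S c ℓ := by
  have h1 : (1 - 10 * c.δ) * ℓ * c.κ = c.κ := by
    have h : (1 - 10 * c.δ) * ℓ = 1 := h22
    rw [h, one_mul]
  refine cammarotaStepWith_of_KP S c ℓ G hsp hrep hA ?_ ?_ ?_ hA₂
  · rw [h1]; exact hκ
  · rw [h1]; exact hlarge
  · rw [smallness_exponent_of_R22gen c h22]; exact hsmall

/-- p. 21 [21], verbatim: *"The inequality (2.41) and the assumptions imply the inequality (I.1.18), with ½E₀ instead of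
E₀, for the terms of the effective action E^{(k+1)} in (I.1.3)."* — now from (2.38)_ℓ itself: Lemma 3's bound + the
polymer geometry + (2.13) + `(1 − 10δ)ℓ = 1` + `O(1)C₃ε₁ ≤ ½E₀` + the explicit largeness/smallness ⇒
`|E^{(k+1)}(X)| ≤ ½E₀ exp(−κ d_{k+1}(X))` (`B13.bound118_of_bound241With` ∘ `cammarotaStepWith_of_KP_R22gen`).
[cite: Balaban1988RG2Cluster, p.21 (after (2.41))] -/
theorem bound118_of_KP (S : B13.StepData) (c : B13.Consts) {ℓ : ℝ} {Cube : Type} [DecidableEq Cube]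
    (G : Geometry S.Dk1 Cube) (hsp : SpRestr S G) (hrep : Repr213 S G) (h238 : Bound238With S c ℓ)
    (h22 : c.R22gen ℓ) (h23 : c.R23) (hA : 0 ≤ c.C3act * c.ε₁) (hκ : 0 ≤ c.κ)
    (hlarge : c.κ + 2 * G.κ₀ + 2 ≤ (1 - 8 * c.δ) * ℓ * c.κ)
    (hsmall : c.C3act * c.ε₁ * Real.exp (5 * c.κ + 1) * G.K₀ * G.ν * G.c₁ ≤ 1)
    (hA₂ : Real.exp 1 * G.ν * G.c₁ * G.K₀ ^ 2 ≤ c.A₂) :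
    Bound118 S.Dk1 S.sp2 S.Ek1 (c.E₀ / 2) c.κ :=
  bound118_of_bound241With S c (cammarotaStepWith_of_KP_R22gen S c G hsp hrep h22 hA hκ hlarge hsmall hA₂ h238)
    h22 h23

/-- The §2 chain of `B13.deliverables_of_chainWith` (pp. 20–22: restrictions + Lemma 3_ℓ + the [26]-step_ℓ +
`(1 − 10δ)ℓ = 1` + `O(1)C₃ε₁ ≤ ½E₀` + the log Z^{(k)} half with `δ₀M ≥ κ` + analyticity, gauge invariance, (I.1.7) ⇒ the
delivered clauses for A_{k+1}) with the hypothesis `CammarotaStepWith S c ℓ` REPLACED by its Kotecký–Preiss discharge: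
the polymer geometry of 𝐃_{k+1}, the restriction property (p. 15), the representation (2.13) and the two explicit
inequalities. [cite: Balaban1988RG2Cluster, pp.20–22 (Lemma 3 to Thm I.3)] -/
theorem deliverables_of_chainWith_KP (S : B13.StepData) (c : B13.Consts) {ℓ : ℝ} {Cube : Type} [DecidableEq Cube]
    (G : Geometry S.Dk1 Cube) (hsp : SpRestr S G) (hrep : Repr213 S G) (hA : 0 ≤ c.C3act * c.ε₁) (hκ : 0 ≤ c.κ)
    (hlarge : c.κ + 2 * G.κ₀ + 2 ≤ (1 - 8 * c.δ) * ℓ * c.κ)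
    (hsmall : c.C3act * c.ε₁ * Real.exp (5 * c.κ + 1) * G.K₀ * G.ν * G.c₁ ≤ 1)
    (hA₂ : Real.exp 1 * G.ν * G.c₁ * G.K₀ ^ 2 ≤ c.A₂)
    (hR : S.Restr) (h3 : Lemma3With S c ℓ) (h22 : c.R22gen ℓ) (h23 : c.R23) (h24 : c.R24) (hE₀ : 0 ≤ c.E₀)
    (hlog : Bound118 S.Dk1 S.sp2 S.Elog (c.E₀ / 2) (c.δ₀ * c.M)) (hrepr : S.Repr17)
    (han : ∀ X, S.Analytic (S.Etot X) (S.sp2 X)) (hg : ∀ X, S.GaugeInv (S.Etot X)) :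
    Deliverables S c :=
  deliverables_of_chainWith S c hR h3 (cammarotaStepWith_of_KP_R22gen S c G hsp hrep h22 hA hκ hlarge hsmall hA₂)
    h22 h23 h24 hE₀ hlog hrepr han hg

end Literature.MathematicalPhysics.QuantumFieldTheory.Balaban1983to89.B13Resummation
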